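import Mathlib

/-!
# Tier4/Line1/InfiniteLattice — rung (C2) of the cocompactness cut of LINE L1: `𝔸_{k,∞} = 𝓞_k + C_∞`, `C_∞` compact

Blind re-derivation cell `pub-hodge-repro`, Tier 4 «PROVE THE STEP» (README §9–§10), LINE L1 (t4-plan-1), cut of the
wall R-c / (I1-c) `quotient_compact` by t4-L1-p5 (S12723, signature file `proofs/t4-L1-p5/I1c-rungs-sig.lean`); rung
(C2) assigned to t4-L3-p2 (lead S12683 (2)).  STATEMENT VERBATIM from the signature file: the image of the ring of
integers in the infinite adele ring `𝔸_{k,∞} = ∏_{v | ∞} k_v` is cocompact — there is a compact `C ⊆ 𝔸_{k,∞}` with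
`𝔸_{k,∞} = 𝓞_k + C`.  Consumed by (C3) `𝔸_k / k` compact (t4-L1-p5), with (C1) strong approximation (t4-L1-p1).

PROOF (Mathlib only; the classical Minkowski lattice).  Along `InfiniteAdeleRing.ringEquiv_mixedSpace k` the infinite
adele ring is `ℝ^{r₁} × ℂ^{r₂}` and the image of `𝓞_k` is the `ℤ`-span of `mixedEmbedding.latticeBasis k`
(`mem_span_latticeBasis`); for `y` in the mixed space, `v := ZSpan.floor (latticeBasis k) y` lies in that span and
`y − v = ZSpan.fract … y` lies in the fundamental parallelotope, whose norm is bounded by `R := Σ_j ‖latticeBasis k j‖`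
(`ZSpan.fundamentalDomain_isBounded`); `v = mixedEmbedding k b` for some `b : 𝓞_k`, and
`ringEquiv (x − algebraMap (b : k)) = y − v` (`mixedEmbedding_eq_algebraMap_comp`).  Componentwise the ring
equivalence is the isometry `extensionEmbeddingOfIsReal` (real places) / `extensionEmbedding` (complex places), so
`‖(x − b) w‖ ≤ R` at every infinite place `w`, i.e. `x − b ∈ C := ∏_w closedBall 0 R`, which is compact
(`isCompact_univ_pi`; each `w.Completion` is isometric to `ℝ` or `ℂ`, so its closed balls are compact).

Nothing here says anything about the status of the Hodge conjecture for CM abelian varieties, which is NOT proved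
(HC_CM is NOT proved by anyone in this repository).
-/

set_option autoImplicit false

noncomputable section

namespace Summit.Ventures.HodgeRepro.Tier4.Line1

open NumberField NumberField.InfinitePlace NumberField.InfinitePlace.Completion
open scoped Classical

/-- Closed balls of the completion of a field at an infinite place are compact (the completion is isometric
to `ℝ` or `ℂ`). -/
theorem isCompact_closedBall_completion {k : Type} [Field k] (w : InfinitePlace k) (x : w.Completion) (r : ℝ) :
    IsCompact (Metric.closedBall x r) := by
  rcases isReal_or_isComplex w with hw | hw
  · have e := isometryEquivRealOfIsReal hw
    have h := (isCompact_closedBall (e x) r).image e.symm.continuous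
    rwa [e.symm.image_closedBall, e.symm_apply_apply] at h
  · have e := isometryEquivComplexOfIsComplex hw
    have h := (isCompact_closedBall (e x) r).image e.symm.continuous
    rwa [e.symm.image_closedBall, e.symm_apply_apply] at h

section C2

variable (k : Type) [Field k] [NumberField k]

omit [NumberField k] in
/-- The product of closed balls of radius `R` at the infinite places is compact in the infinite adele ring. -/
theorem isCompact_pi_closedBall (R : ℝ) :
    IsCompact {z : InfiniteAdeleRing k | ∀ w : InfinitePlace k, ‖z w‖ ≤ R} := by
  have h : {z : InfiniteAdeleRing k | ∀ w : InfinitePlace k, ‖z w‖ ≤ R} =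
      Set.pi Set.univ (fun w : InfinitePlace k => Metric.closedBall (0 : w.Completion) R) := by
    ext z
    constructor
    · intro hz w _
      simpa [Metric.mem_closedBall, dist_zero_right] using hz w
    · intro hz w
      simpa [Metric.mem_closedBall, dist_zero_right] using hz w (Set.mem_univ w)
  rw [h]
  exact isCompact_univ_pi fun w => isCompact_closedBall_completion w 0 R

/-- The norm of a component of an element of the infinite adele ring is bounded by the norm of its image in the
mixed space (the components of `ringEquiv_mixedSpace` are isometries). -/
theorem norm_apply_le_norm_ringEquiv (z : InfiniteAdeleRing k) (w : InfinitePlace k) :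
    ‖z w‖ ≤ ‖InfiniteAdeleRing.ringEquiv_mixedSpace k z‖ := by
  rcases isReal_or_isComplex w with hw | hw
  · have h1 : ‖z w‖ = ‖extensionEmbeddingOfIsReal hw (z w)‖ :=
      ((isometry_extensionEmbeddingOfIsReal hw).norm_map_of_map_zero (map_zero _) (z w)).symm
    rw [h1]
    calc ‖extensionEmbeddingOfIsReal hw (z w)‖
        = ‖(InfiniteAdeleRing.ringEquiv_mixedSpace k z).1 ⟨w, hw⟩‖ := by
          rw [InfiniteAdeleRing.ringEquiv_mixedSpace_apply]
      _ ≤ ‖(InfiniteAdeleRing.ringEquiv_mixedSpace k z).1‖ := norm_le_pi_norm _ _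
      _ ≤ ‖InfiniteAdeleRing.ringEquiv_mixedSpace k z‖ := norm_fst_le _
  · have h1 : ‖z w‖ = ‖extensionEmbedding w (z w)‖ :=
      ((isometry_extensionEmbedding w).norm_map_of_map_zero (map_zero _) (z w)).symm
    rw [h1]
    calc ‖extensionEmbedding w (z w)‖
        = ‖(InfiniteAdeleRing.ringEquiv_mixedSpace k z).2 ⟨w, hw⟩‖ := by
          rw [InfiniteAdeleRing.ringEquiv_mixedSpace_apply]
      _ ≤ ‖(InfiniteAdeleRing.ringEquiv_mixedSpace k z).2‖ := norm_le_pi_norm _ _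
      _ ≤ ‖InfiniteAdeleRing.ringEquiv_mixedSpace k z‖ := norm_snd_le _

/-- (C2, M, t4-L3-p2) THE ARCHIMEDEAN LATTICE: `𝔸_{k,∞} = 𝓞_k + C_∞` with `C_∞` compact.  Proof: Mathlib's
`NumberField.mixedEmbedding.latticeBasis` spans the image of `𝓞_k` in `ℝ^{r₁} × ℂ^{r₂}` (`span_latticeBasis`), its
`ZSpan.fundamentalDomain` is bounded (`ZSpan.fundamentalDomain_isBounded`) and every point is a lattice point plus a
point of it (`ZSpan.exist_unique_vsub_mem_fundamentalDomain`); transport along `InfiniteAdeleRing.ringEquiv_mixedSpace`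
(a homeomorphism: both sides are finite products of the completions). -/
theorem exists_compact_add_ringOfIntegers_infinite :
    ∃ C : Set (InfiniteAdeleRing k), IsCompact C ∧
      ∀ x : InfiniteAdeleRing k, ∃ b : 𝓞 k, x - algebraMap k (InfiniteAdeleRing k) (b : k) ∈ C := by
  classical
  set b := mixedEmbedding.latticeBasis k with hb
  obtain ⟨R, hR⟩ := isBounded_iff_forall_norm_le.mp (ZSpan.fundamentalDomain_isBounded b)
  refine ⟨{z : InfiniteAdeleRing k | ∀ w : InfinitePlace k, ‖z w‖ ≤ R}, isCompact_pi_closedBall k R, ?_⟩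
  intro x
  set y := InfiniteAdeleRing.ringEquiv_mixedSpace k x with hy
  -- the lattice point below `y`
  have hv : ((ZSpan.floor b y : Submodule.span ℤ (Set.range b)) : mixedEmbedding.mixedSpace k) ∈
      mixedEmbedding.integerLattice k :=
    (mixedEmbedding.mem_span_latticeBasis k).mp (ZSpan.floor b y).2
  obtain ⟨c, hc⟩ := hv
  refine ⟨c, ?_⟩
  -- the difference is the fractional part, bounded by `R`
  have hfract : y - (ZSpan.floor b y : mixedEmbedding.mixedSpace k) ∈ ZSpan.fundamentalDomain b :=
    ZSpan.fract_mem_fundamentalDomain b y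
  have hnorm : ‖y - (ZSpan.floor b y : mixedEmbedding.mixedSpace k)‖ ≤ R := hR _ hfract
  have hdiff : InfiniteAdeleRing.ringEquiv_mixedSpace k (x - algebraMap k (InfiniteAdeleRing k) (c : k)) =
      y - (ZSpan.floor b y : mixedEmbedding.mixedSpace k) := by
    rw [map_sub, ← hc, ← InfiniteAdeleRing.mixedEmbedding_eq_algebraMap_comp]
    rfl
  intro w
  calc ‖(x - algebraMap k (InfiniteAdeleRing k) (c : k)) w‖
      ≤ ‖InfiniteAdeleRing.ringEquiv_mixedSpace k (x - algebraMap k (InfiniteAdeleRing k) (c : k))‖ :=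
        norm_apply_le_norm_ringEquiv k _ w
    _ = ‖y - (ZSpan.floor b y : mixedEmbedding.mixedSpace k)‖ := by rw [hdiff]
    _ ≤ R := hnorm

end C2

end Summit.Ventures.HodgeRepro.Tier4.Line1

end
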